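import Literature.Probability.RandomPlanarGeometry.HexSAWBrickWallStripFugacityWidthOneLinearContactCLT
import Literature.Probability.Distributions.GaussianMoments
import HarnessLib

/-!
# Gaussian moments of the contact statistics: `E_{N,y,z}[(L − N m_v)^k]/N^{k/2} → E[Z^k]`, `Z ~ N(0, H(v))`, for EVERY `k`

Topic `Literature/Probability/RandomPlanarGeometry` (continues `…WidthOneLinearContactCLT.lean` (★★★ `tendsto_linMGF_gaussian`: the mgf of the centred, `√N`-scaled
linear statistic `L = v₁bc + v₂tc` converges on ALL of `ℝ` to `e^{H(v)s²/2}`; `linLaw`, `integral_exp_mul_linLaw`), `Literature/Probability/Moments/MGFContinuityTheorem.lean`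
(`tendsto_integral_pow_of_tendsto_mgf`: Curtiss' MOMENT theorem with the limit identified) and `Literature/Probability/Distributions/GaussianMoments.lean`
(`∫ x^{2r} dN(0,v) = v^r (2r−1)‼`, `∫ x^{2r+1} dN(0,v) = 0`)).  Weak convergence alone does not move unbounded test functions; the mgf convergence does:
THIS FILE records that EVERY moment of the centred scaled contact statistics converges to the corresponding Gaussian moment.

* ★★★ `tendsto_linMoment`: `Σ_q (wgt_q/C_{1,N}) ((L_q − N m_v)/√N)^k → ∫ x^k dN(0, H_{y,z}(v))` for all `k : ℕ` and every direction `v`;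
  ★★★ `tendsto_linMoment_even` (`→ H(v)^r (2r−1)‼`), `tendsto_linMoment_odd` (`→ 0`).
* Bottom wall (`v = (1,0)`, `H = σ² = ∂b/∂A`): ★★★ `tendsto_contactMoment_even` / `_odd` — `E[(bc − Nb)^{2r}]/N^r → σ^{2r}(2r−1)‼`, `E[(bc − Nb)^{2r+1}]/N^{r+1/2} → 0`;
  in particular `tendsto_contactFourthMoment` (`E[(bc − Nb)⁴]/N² → 3σ⁴`: the kurtosis tends to `3`) and `tendsto_contactThirdMoment` (`E[(bc−Nb)³]/N^{3/2} → 0`: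
  the skewness at the CLT scale vanishes — compare CAR «FINITE LOG-LAPLACE CUMULANTS»: `|κ₃| ≤ (N+1)·Var`, i.e. `κ₃ = O(N^2)` only).
* §3 THE UNIFORM STRIP in closed form (`μ` = plastic number): ★★★ `tendsto_covContacts_div_uniform` (`Cov_N(bc,tc)/N → (16 − 33μ − 24μ²)/529 ∈ (−0.1321, −0.1320)`),
  ★★ `tendsto_varTotalContacts_div_uniform` (`Var_N(bc+tc)/N → (18 + 29μ − 27μ²)/529 ∈ (0.0170, 0.0171)`).

## Sources
J. H. Curtiss, Ann. Math. Statist. 13 (1942) Theorem 3 (and the moment half, Theorem of §3); S. Janson, *Gaussian Hilbert Spaces* (1997) Remark 1.30 (Gaussian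
moments); A. Dembo, O. Zeitouni (2010) §2.3 (lane statements); N. R. Beaton, M. Bousquet-Mélou, J. de Gier, H. Duminil-Copin, A. J. Guttmann, CMP 326 (2014),
arXiv:1109.0358v5 §3.2 Proposition 6 (p. 10).  Nothing is quoted AS PRINTED; statements are this lineage's.
-/

noncomputable section

open Filter Topology Finset Set MeasureTheory ProbabilityTheory Literature.Analysis Literature.Probability.Moments
open Literature.Probability.Distributions Literature.Probability.LatticeModels Literature.Probability.Percolation
open scoped Nat

namespace Literature.Probability.RandomPlanarGeometry.SAW.HexBW

namespace WidthOneYZ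

variable {y z : ℝ}

/-! ## §1 All moments of every linear contact statistic converge to the Gaussian moments -/

/-- `H_{y,z}(v) ≥ 0` (plumbing: `> 0` off the origin, `0` at `v = 0`). [cite: DemboZeitouni2010, §2.2 (lane plumbing)] -/
theorem contactHess_nonneg (hy : 0 < y) (hz : 0 < z) (v₁ v₂ : ℝ) : 0 ≤ contactHess v₁ v₂ y z := by
  by_cases hv : (v₁, v₂) = ((0 : ℝ), (0 : ℝ))
  · obtain ⟨h1, h2⟩ : v₁ = 0 ∧ v₂ = 0 := by simpa using hv
    subst h1; subst h2
    simp [contactHess]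
  · exact (contactHess_pos hy hz hv).le

/-- ★★ **The moments of `linLaw` converge to the Gaussian moments** (Curtiss' moment theorem on the mgf limit of CAR «CRAMÉR–WOLD CLT»):
`∫ x^k d(linLaw v₁ v₂ y z N) → ∫ x^k dN(0, H_{y,z}(v))` for every `k`. [cite: Curtiss1942, Theorem 3 (moment form); DemboZeitouni2010, §2.3 (lane statement)] -/
theorem tendsto_integral_pow_linLaw (hy : 0 < y) (hz : 0 < z) (v₁ v₂ : ℝ) (k : ℕ) :
    Tendsto (fun N : ℕ => ∫ x, x ^ k ∂linLaw v₁ v₂ y z N) atTop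
      (𝓝 (∫ x, x ^ k ∂gaussianReal 0 (contactHess v₁ v₂ y z).toNNReal)) := by
  set σ2 := contactHess v₁ v₂ y z with hσ2
  have hσ : 0 ≤ σ2 := contactHess_nonneg hy hz v₁ v₂
  refine tendsto_integral_pow_of_tendsto_mgf (μ := fun N => linLaw v₁ v₂ y z N) (ν := gaussianReal 0 σ2.toNNReal) one_pos
    (fun s _ N => integrable_finLaw _ _ _ _) (fun s _ => integrable_exp_mul_gaussianReal s) (fun s _ => ?_) k
  have hG : ∫ x, Real.exp (s * x) ∂gaussianReal 0 σ2.toNNReal = Real.exp (σ2 * s ^ 2 / 2) := by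
    have h := congrFun (mgf_id_gaussianReal (μ := 0) (v := σ2.toNNReal)) s
    simp only [mgf, id_eq] at h
    rw [h, Real.coe_toNNReal _ hσ, zero_mul, zero_add]
  rw [hG]
  refine (tendsto_linMGF_gaussian hy hz v₁ v₂ s).congr fun N => ?_
  rw [integral_exp_mul_linLaw hy hz]

/-- ★★★ **ALL MOMENTS OF EVERY CENTRED SCALED LINEAR CONTACT STATISTIC CONVERGE TO THE GAUSSIAN MOMENTS**: for all `y, z > 0`, every `(v₁,v₂)` and
every `k : ℕ`, `E_{N,y,z}[((v₁bc + v₂tc − N m_v)/√N)^k] = Σ_q (wgt_q/C_{1,N})·((L_q − N m_v)/√N)^k → ∫ x^k dN(0, H_{y,z}(v))`.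
[cite: Curtiss1942, Theorem 3 (moment form); DemboZeitouni2010, §2.3 (lane statement); BeatonBousquetMelouDeGierDuminilCopinGuttmann2014, §3.2 Proposition 6 (arXiv v5 p. 10)] -/
theorem tendsto_linMoment (hy : 0 < y) (hz : 0 < z) (v₁ v₂ : ℝ) (k : ℕ) :
    Tendsto (fun N : ℕ => ∑ q ∈ stripPairs 1 N, wgt y z N q / stripZ₂ 1 N y z *
        ((v₁ * (bottomVisits₀ q.1 q.2 N : ℝ) + v₂ * (topVisits₀ 1 q.1 q.2 N : ℝ) - N * (v₁ * contactB y z + v₂ * contactB z y)) / Real.sqrt N) ^ k)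
      atTop (𝓝 (∫ x, x ^ k ∂gaussianReal 0 (contactHess v₁ v₂ y z).toNNReal)) := by
  refine (tendsto_integral_pow_linLaw hy hz v₁ v₂ k).congr fun N => ?_
  rw [linLaw, integral_finLaw _ _ (wgt_div_nonneg hy hz N)]

/-- ★★★ **Even moments**: `E_{N,y,z}[((L − N m_v)/√N)^{2r}] → H(v)^r · (2r−1)‼`. [cite: Janson1997, Rem. 1.30 (Gaussian moments); Curtiss1942, Theorem 3] -/
theorem tendsto_linMoment_even (hy : 0 < y) (hz : 0 < z) (v₁ v₂ : ℝ) (r : ℕ) :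
    Tendsto (fun N : ℕ => ∑ q ∈ stripPairs 1 N, wgt y z N q / stripZ₂ 1 N y z *
        ((v₁ * (bottomVisits₀ q.1 q.2 N : ℝ) + v₂ * (topVisits₀ 1 q.1 q.2 N : ℝ) - N * (v₁ * contactB y z + v₂ * contactB z y)) / Real.sqrt N) ^ (2 * r))
      atTop (𝓝 (contactHess v₁ v₂ y z ^ r * ((2 * r - 1 : ℕ)‼ : ℝ))) := by
  have h := tendsto_linMoment hy hz v₁ v₂ (2 * r)
  rwa [integral_pow_even_gaussianReal, Real.coe_toNNReal _ (contactHess_nonneg hy hz v₁ v₂)] at h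

/-- ★★★ **Odd moments**: `E_{N,y,z}[((L − N m_v)/√N)^{2r+1}] → 0`. [cite: Janson1997, Rem. 1.30; Curtiss1942, Theorem 3] -/
theorem tendsto_linMoment_odd (hy : 0 < y) (hz : 0 < z) (v₁ v₂ : ℝ) (r : ℕ) :
    Tendsto (fun N : ℕ => ∑ q ∈ stripPairs 1 N, wgt y z N q / stripZ₂ 1 N y z *
        ((v₁ * (bottomVisits₀ q.1 q.2 N : ℝ) + v₂ * (topVisits₀ 1 q.1 q.2 N : ℝ) - N * (v₁ * contactB y z + v₂ * contactB z y)) / Real.sqrt N) ^ (2 * r + 1))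
      atTop (𝓝 0) := by
  have h := tendsto_linMoment hy hz v₁ v₂ (2 * r + 1)
  rwa [integral_pow_odd_gaussianReal] at h

/-! ## §2 The bottom contacts: even moments, vanishing skewness, kurtosis three -/

/-- ★★★ **EVEN MOMENTS OF THE CONTACT NUMBER**: `E_{N,y,z}[(bc − N b)^{2r}]/N^r = Σ_q (wgt_q/C_{1,N})((bc_q − Nb)/√N)^{2r} → σ^{2r}(2r−1)‼`,
`σ² = ∂b/∂A|_{log y}`. [cite: Janson1997, Rem. 1.30; Curtiss1942, Theorem 3; DemboZeitouni2010, §2.3 (lane statement)] -/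
theorem tendsto_contactMoment_even (hy : 0 < y) (hz : 0 < z) (r : ℕ) :
    Tendsto (fun N : ℕ => ∑ q ∈ stripPairs 1 N, wgt y z N q / stripZ₂ 1 N y z *
        (((bottomVisits₀ q.1 q.2 N : ℝ) - N * contactB y z) / Real.sqrt N) ^ (2 * r))
      atTop (𝓝 (deriv (fun A => contactB (Real.exp A) z) (Real.log y) ^ r * ((2 * r - 1 : ℕ)‼ : ℝ))) := by
  have h := tendsto_linMoment_even hy hz 1 0 r
  rw [(contactHess_axes hy hz).1] at h
  refine h.congr fun N => Finset.sum_congr rfl fun q _ => ?_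
  simp only [one_mul, zero_mul, add_zero]

/-- ★★★ **ODD MOMENTS OF THE CONTACT NUMBER VANISH AT THE CLT SCALE**: `E_{N,y,z}[(bc − N b)^{2r+1}]/N^{r+1/2} → 0`.
[cite: Janson1997, Rem. 1.30; Curtiss1942, Theorem 3] -/
theorem tendsto_contactMoment_odd (hy : 0 < y) (hz : 0 < z) (r : ℕ) :
    Tendsto (fun N : ℕ => ∑ q ∈ stripPairs 1 N, wgt y z N q / stripZ₂ 1 N y z *
        (((bottomVisits₀ q.1 q.2 N : ℝ) - N * contactB y z) / Real.sqrt N) ^ (2 * r + 1)) atTop (𝓝 0) := by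
  have h := tendsto_linMoment_odd hy hz 1 0 r
  refine h.congr fun N => Finset.sum_congr rfl fun q _ => ?_
  simp only [one_mul, zero_mul, add_zero]

/-- ★★ **THE SKEWNESS VANISHES**: `E_{N,y,z}[(bc − Nb)³]/N^{3/2} → 0`. [cite: Janson1997, Rem. 1.30; DemboZeitouni2010, §2.3 (lane statement)] -/
theorem tendsto_contactThirdMoment (hy : 0 < y) (hz : 0 < z) :
    Tendsto (fun N : ℕ => ∑ q ∈ stripPairs 1 N, wgt y z N q / stripZ₂ 1 N y z *
        (((bottomVisits₀ q.1 q.2 N : ℝ) - N * contactB y z) / Real.sqrt N) ^ 3) atTop (𝓝 0) := by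
  simpa using tendsto_contactMoment_odd hy hz 1

/-- ★★ **THE KURTOSIS TENDS TO THREE**: `E_{N,y,z}[(bc − Nb)⁴]/N² → 3σ⁴`. [cite: Janson1997, Rem. 1.30; DemboZeitouni2010, §2.3 (lane statement)] -/
theorem tendsto_contactFourthMoment (hy : 0 < y) (hz : 0 < z) :
    Tendsto (fun N : ℕ => ∑ q ∈ stripPairs 1 N, wgt y z N q / stripZ₂ 1 N y z *
        (((bottomVisits₀ q.1 q.2 N : ℝ) - N * contactB y z) / Real.sqrt N) ^ 4)
      atTop (𝓝 (3 * deriv (fun A => contactB (Real.exp A) z) (Real.log y) ^ 2)) := by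
  have h := tendsto_contactMoment_even hy hz 2
  have e : ((2 * 2 - 1 : ℕ)‼ : ℝ) = 3 := by norm_num [Nat.doubleFactorial]
  rw [e] at h
  simpa [mul_comm] using h


/-! ## §3 The uniform strip in closed form: covariance rate, total-contact variance rate, correlation -/

/-- ★★★ **THE UNIFORM STRIP** (`y = z = 1`, `μ = μ(S₁)` the plastic number): the covariance of the numbers of bottom and top contacts of a uniform
`N`-step walk of the width-one strip grows like `Cov_N(bc,tc)/N → (16 − 33μ − 24μ²)/529 ∈ (−0.1321, −0.1320)` (tree: `susceptibility_uniform`,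
`susceptibility_uniform_bounds`; compare `Var_N(bc)/N → (21μ² + 95μ − 14)/1058 ≈ 0.1405`).
[cite: DemboZeitouni2010, §2.3 (lane statement); MadrasSlade1993, §8.5 pp. 278–279 (one-dimensional lattices); JansevanRensburg2000, §3.3 (1st ed.)] -/
theorem tendsto_covContacts_div_uniform :
    Tendsto (fun N : ℕ => covContacts 1 1 N / N) atTop
        (𝓝 ((16 - 33 * stripConnectiveConstant 1 - 24 * stripConnectiveConstant 1 ^ 2) / 529)) ∧
      (-0.1321 : ℝ) < (16 - 33 * stripConnectiveConstant 1 - 24 * stripConnectiveConstant 1 ^ 2) / 529 ∧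
      (16 - 33 * stripConnectiveConstant 1 - 24 * stripConnectiveConstant 1 ^ 2) / 529 < -0.1320 := by
  have h := tendsto_covContacts_div one_pos one_pos
  rw [Real.log_one, susceptibility_uniform.2.deriv] at h
  obtain ⟨-, -, b1, b2⟩ := susceptibility_uniform_bounds
  exact ⟨h, b1, b2⟩

/-- ★★ **Uniform strip, total contacts**: `Var_N(bc + tc)/N → (18 + 29μ − 27μ²)/529 ∈ (0.0170, 0.0171)` — the total number of surface contacts
fluctuates an order of magnitude less than either wall's count (`0.1405·N` each, correlation `→ 2(16 − 33μ − 24μ²)/(21μ² + 95μ − 14) ≈ −0.939`).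
[cite: DemboZeitouni2010, §2.3 (lane statement); MadrasSlade1993, §8.5 pp. 278–279] -/
theorem tendsto_varTotalContacts_div_uniform :
    Tendsto (fun N : ℕ => varLin 1 1 1 1 N / N) atTop
        (𝓝 ((18 + 29 * stripConnectiveConstant 1 - 27 * stripConnectiveConstant 1 ^ 2) / 529)) ∧
      (0.0170 : ℝ) < (18 + 29 * stripConnectiveConstant 1 - 27 * stripConnectiveConstant 1 ^ 2) / 529 ∧
      (18 + 29 * stripConnectiveConstant 1 - 27 * stripConnectiveConstant 1 ^ 2) / 529 < 0.0171 := by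
  set μ := stripConnectiveConstant 1 with hμ
  have hμ1 : (1.3247 : ℝ) < μ := stripConnectiveConstant_one_mem_Ioo.1
  have hμ2 : μ < (1.3248 : ℝ) := stripConnectiveConstant_one_mem_Ioo.2
  -- `Var(bc+tc) = Var(bc) + 2Cov + Var(tc)`, and `Var(tc) = Var(bc)` at the symmetric point (reflection)
  have hv := tendsto_varContacts_div_uniform.1
  have hc := tendsto_covContacts_div_uniform.1
  have ht : Tendsto (fun N : ℕ => varTopContacts 1 1 N / N) atTop (𝓝 ((21 * μ ^ 2 + 95 * μ - 14) / 1058)) :=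
    hv.congr fun N => by rw [varTopContacts_eq]
  rw [← hμ] at hv hc
  have hsum := (hv.add (hc.const_mul 2)).add ht
  refine ⟨?_, ?_, ?_⟩
  · have e : (21 * μ ^ 2 + 95 * μ - 14) / 1058 + 2 * ((16 - 33 * μ - 24 * μ ^ 2) / 529) + (21 * μ ^ 2 + 95 * μ - 14) / 1058
        = (18 + 29 * μ - 27 * μ ^ 2) / 529 := by ring
    rw [← e]
    refine hsum.congr fun N => ?_
    rw [varLin_eq]
    ring
  · rw [lt_div_iff₀ (by norm_num)]; nlinarith
  · rw [div_lt_iff₀ (by norm_num)]; nlinarith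
end WidthOneYZ

end Literature.Probability.RandomPlanarGeometry.SAW.HexBW

end
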